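import Literature.AlgebraicGeometry.Resolution.DiffOpSmoothExtension
import Literature.AlgebraicGeometry.Resolution.DiffIdealSheaf
import Literature.AlgebraicGeometry.Resolution.DerivativeIdealsBlowup
import Literature.AlgebraicGeometry.Resolution.MarkedIdealsLemmas
import Mathlib.AlgebraicGeometry.Morphisms.Smooth
import HarnessLib

/-!
# `Diff^{≤ n}` ideal sheaves grow under smooth (in particular étale, open) pull-back: `ψ^* Diff^{≤n}(𝓘) ⊆ Diff^{≤n}(ψ^*𝓘)`

Topic `Literature/AlgebraicGeometry/Resolution`; the all-orders, all-characteristics analogue of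
`DerivativeIdealsEtale.comap_derivIdealSheafIter_le_of_etale` (derivations, étale `ψ`), for the ideal sheaves
`diffIdealSheaf φ n 𝓘` of `DiffIdealSheaf.lean` (Grothendieck's differential operators of order `≤ n`, EGA IV₄ §16.8,
on a scheme whose affine pieces are of finite type over a field `K`).

* `comap_diffIdealSheaf_le_of_smooth` — for a SMOOTH morphism `ψ : U → X` (Mathlib `Smooth`; étale morphisms and open
  immersions are smooth) and the induced `K`-structure `ψ^* ∘ φ` on `U`:
  `(Diff^{≤ n}_X(𝓘)) · O_U ⊆ Diff^{≤ n}_U(𝓘 · O_U)`. Checked on affine opens `W ⊆ ψ⁻¹ V`, where `Γ(X,V) → Γ(U,W)` is a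
  smooth — hence formally smooth — `K`-algebra map (`HasRingHomProperty @Smooth`) and the ring-level statement is
  `algebraMap_mem_diffIdeal_of_formallySmooth` (`DiffOpSmoothExtension.lean`: differential operators of order `≤ n`
  extend along formally smooth algebras).

Equality (for étale `ψ`) would need the generation half «`Diff_U = O_U ⊗ Diff_X`» and is not proved here.
Sources: [EGAIV4] §16.8 (Prop. 16.8.6, 16.8.8), Déf. (17.1.1), Prop. (17.2.3); [Kollar2007] 3.74.5 is the derivation case.
-/

noncomputable section

open CategoryTheory AlgebraicGeometry TopologicalSpace

namespace Literature.AlgebraicGeometry.Resolution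

universe u v

section SheafLevel

variable {K : Type v} [Field K] {U X : Scheme.{u}} (ψ : U ⟶ X) (φ : K →+* Γ(X, ⊤))

/-- **`Diff^{≤ n}` ideal sheaves grow under smooth pull-back**: for a smooth `ψ : U → X` and the `K`-structure
`ψ^* ∘ φ` on `U` (affine pieces of finite type over `K` on both sides),
`ψ^* Diff^{≤ n}_X(𝓘) ⊆ Diff^{≤ n}_U(ψ^* 𝓘)`. Stalkwise on affine opens `W ⊆ ψ⁻¹V`; the ring map `Γ(X,V) → Γ(U,W)` is
smooth, so every differential operator of `Γ(X,V)` of order `≤ n` extends to `Γ(U,W)`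
(`algebraMap_mem_diffIdeal_of_formallySmooth`).
[cite: EGAIV4, Prop. (16.8.6) p.41, Prop. (16.8.8) p.42, Déf. (17.1.1), Prop. (17.2.3); Kollar2007, 3.74.5 (the derivation case)] -/
theorem comap_diffIdealSheaf_le_of_smooth [Smooth ψ] (hX : HasFiniteTypeSections φ)
    (hU : HasFiniteTypeSections (ψ.appTop.hom.comp φ)) (n : ℕ) (I : X.IdealSheafData) :
    (diffIdealSheaf φ n I).comap ψ ≤ diffIdealSheaf (ψ.appTop.hom.comp φ) n (I.comap ψ) := by
  refine le_of_forall_stalkIdeal_le fun x => ?_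
  obtain ⟨V, hV, hxV, -⟩ :=
    exists_isAffineOpen_mem_and_subset (X := X) (x := ψ x) (U := ⊤) (Opens.mem_top _)
  obtain ⟨W, hW, hxW, hWV⟩ :=
    exists_isAffineOpen_mem_and_subset (X := U) (x := x) (U := ψ ⁻¹ᵁ V) hxV
  let V' : X.affineOpens := ⟨V, hV⟩
  let W' : U.affineOpens := ⟨W, hW⟩
  have e : (W' : U.Opens) ≤ ψ ⁻¹ᵁ (V' : X.Opens) := hWV
  rw [stalkIdeal_eq_map_germ _ W' hxW, stalkIdeal_eq_map_germ _ W' hxW]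
  refine Ideal.map_mono ?_
  rw [ideal_comap_of_le ψ _ V' W' e, diffIdealSheaf_ideal hX, diffIdealSheaf_ideal hU, ideal_comap_of_le ψ I V' W' e]
  letI := sectionsAlgebra φ V'.1
  letI := sectionsAlgebra (ψ.appTop.hom.comp φ) W'.1
  letI alg : Algebra Γ(X, V'.1) Γ(U, W'.1) := (ψ.appLE V' W' e).hom.toAlgebra
  haveI : IsScalarTower K Γ(X, V'.1) Γ(U, W'.1) :=
    IsScalarTower.of_algebraMap_eq' (appLE_comp_sectionsHom φ ψ V' W' e).symm
  have hsm : (ψ.appLE V' W' e).hom.Smooth := HasRingHomProperty.appLE @Smooth ψ inferInstance V' W' e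
  haveI : Algebra.Smooth Γ(X, V'.1) Γ(U, W'.1) := hsm
  haveI : Algebra.FormallySmooth Γ(X, V'.1) Γ(U, W'.1) := inferInstance
  rw [Ideal.map_le_iff_le_comap]
  intro y hy
  exact algebraMap_mem_diffIdeal_of_formallySmooth K hy

end SheafLevel

end Literature.AlgebraicGeometry.Resolution

end
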